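import Mathlib.Analysis.SpecialFunctions.Pow.Deriv
import Mathlib.Analysis.SpecialFunctions.Pow.Continuity
import Literature.NumberTheory.Transcendental.KZCalculusProofs

/-!
# The Elliott family in the modulus: the divergence certificate (engine client E-L1)

Line `cusp-transport-to-the-beta-world` of the crux `CompleteModGammaSector`
(stmt-KontsevichZagierPeriods-14233), second client of the certificate-transport engine E2'
(`stub_certificateTransport`): the Elliott bilinear hypergeometric family, transported in the
modulus down to the cusp; stubs `stub_elliottCertificate` and `stub_elliottContinuousModulus`.

Parameters: rational `0 < a < 1`, `1 − a < c`; `t, u ∈ (0, 1)`. With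
`K(t, u, σ) = t^{−a} (1 − t)^{c+a−2} (1 − σ t)^{−a} · u^{−a} (1 − u)^{c+a−2} (1 − (1 − σ) u)^{−a}`
the one-parameter family of integrands is `F(σ; t, u) = K(t, u, σ) · (1 − σ t − (1 − σ) u)`; only
the factors `(1 − σ t)^{−a}` and `(1 − (1 − σ) u)^{−a}` of `K` depend on the modulus `σ`.

* `stub_elliottCertificate`: the CERTIFICATE `∂_σ F = g₁ + g₂` at `σ = s ∈ (0, 1)`, where
  `g₁ = K u [(1 − 2t) − a(1 − t) − (c + a − 2) t + a s t (1 − t)/(1 − s t)]` (`= ∂ₜ P`) and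
  `g₂ = −K t [(1 − 2u) − a(1 − u) − (c + a − 2) u + a (1 − s) u (1 − u)/(1 − (1 − s) u)]`
  (`= ∂ᵤ Q`), an exact identity. Proof: with `p = 1 − s t > 0`, `q = 1 − (1 − s) u > 0`,
  `∂_σ (1 − σ t)^{−a} = a t (1 − s t)^{−a}/p` and `∂_σ (1 − (1 − σ) u)^{−a} = −a u (1 − (1 − s) u)^{−a}/q`
  (`HasDerivAt.rpow_const`, `Real.rpow_sub_one`), the product rule, and the identity
  `∂_σ F − (g₁ + g₂) = K a [t (1 − u) (p p⁻¹ − 1) − u (1 − t) (q q⁻¹ − 1)] = 0`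
  (`linear_combination`).
* `stub_elliottContinuousModulus`: continuity of `σ ↦ F(σ; t, u)` on `[0, z₁]`, `z₁ < 1`, for
  interior `(t, u)`: the two bases `1 − σ t ≥ 1 − z₁ t > 0` and `1 − (1 − σ) u ≥ 1 − u > 0` do
  not vanish there (`ContinuousOn.rpow_const`); there is no singularity at the cusp `σ = 0`.

## References

* M. Kontsevich, D. Zagier, *Periods*, in: Mathematics Unlimited — 2001 and Beyond, Springer
  (2001), §1.2 (Legendre's relation between periods, to be proved "by the rules").
* E. B. Elliott, *A formula including Legendre's `EK′ + KE′ − KK′ = ½π`*, Messenger of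
  Mathematics 33 (1904).
-/

noncomputable section
set_option linter.dupNamespace false

namespace Summit.KontsevichZagierPeriods.KontsevichZagierPeriods.CompleteModGammaSectorEngine

open MeasureTheory Set
open Literature.NumberTheory.Transcendental
open Literature.NumberTheory.Transcendental.KZ

/-- `d/dσ (1 − σ p)^e = −(p e) · (1 − m p)^e/(1 − m p)` at `σ = m`, provided `1 − m p ≠ 0`.
[folklore] -/
private theorem hasDerivAt_rpow_one_sub_mul {p m e : ℝ} (h : 1 - m * p ≠ 0) :
    HasDerivAt (fun σ : ℝ => (1 - σ * p) ^ e) (-(p * e) * ((1 - m * p) ^ e / (1 - m * p))) m := by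
  have h1 : HasDerivAt (fun σ : ℝ => 1 - σ * p) (-(1 * p)) m :=
    ((hasDerivAt_id' m).mul_const p).const_sub 1
  refine (h1.rpow_const (Or.inl h)).congr_deriv ?_
  rw [Real.rpow_sub_one h]
  ring

/-- `d/dσ (1 − (1 − σ) q)^e = (q e) · (1 − (1 − m) q)^e/(1 − (1 − m) q)` at `σ = m`, provided
`1 − (1 − m) q ≠ 0`. [folklore] -/
private theorem hasDerivAt_rpow_one_sub_one_sub_mul {q m e : ℝ} (h : 1 - (1 - m) * q ≠ 0) :
    HasDerivAt (fun σ : ℝ => (1 - (1 - σ) * q) ^ e)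
      (q * e * ((1 - (1 - m) * q) ^ e / (1 - (1 - m) * q))) m := by
  have h1 : HasDerivAt (fun σ : ℝ => 1 - (1 - σ) * q) (-(-1 * q)) m :=
    (((hasDerivAt_id' m).const_sub 1).mul_const q).const_sub 1
  refine (h1.rpow_const (Or.inl h)).congr_deriv ?_
  rw [Real.rpow_sub_one h]
  ring

/-- **The Elliott certificate** (engine client E-L1). For rational `0 < a < 1`, `1 − a < c` and
`t, u, s ∈ (0, 1)`, the modulus-derivative at `σ = s` of the Elliott family
`F(σ; t, u) = K(t, u, σ) (1 − σ t − (1 − σ) u)`,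
`K = t^{−a}(1 − t)^{c+a−2}(1 − σ t)^{−a} u^{−a}(1 − u)^{c+a−2}(1 − (1 − σ) u)^{−a}`, is the divergence
`g₁ + g₂ = ∂ₜ P + ∂ᵤ Q` with `g₁ = K u [(1 − 2t) − a(1 − t) − (c + a − 2) t + a s t(1 − t)/(1 − s t)]`,
`g₂ = −K t [(1 − 2u) − a(1 − u) − (c + a − 2) u + a(1 − s) u(1 − u)/(1 − (1 − s) u)]`
(an exact identity; see the module docstring for the computation). [folklore] -/
theorem stub_elliottCertificate :
    ∀ (a c : ℚ) (t u s : ℝ), 0 < a → a < 1 → 1 - a < c → t ∈ Set.Ioo (0:ℝ) 1 → u ∈ Set.Ioo (0:ℝ) 1 → s ∈ Set.Ioo (0:ℝ) 1 → HasDerivAt (fun σ : ℝ => ((t ^ (-(a : ℝ)) * (1 - t) ^ ((c : ℝ) + (a : ℝ) - 2) * (1 - σ * t) ^ (-(a : ℝ)) * u ^ (-(a : ℝ)) * (1 - u) ^ ((c : ℝ) + (a : ℝ) - 2) * (1 - (1 - σ) * u) ^ (-(a : ℝ))) * (1 - σ * t - (1 - σ) * u))) (((t ^ (-(a : ℝ))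 * (1 - t) ^ ((c : ℝ) + (a : ℝ) - 2) * (1 - s * t) ^ (-(a : ℝ)) * u ^ (-(a : ℝ)) * (1 - u) ^ ((c : ℝ) + (a : ℝ) - 2) * (1 - (1 - s) * u) ^ (-(a : ℝ))) * u * ((1 - 2 * t) - (a : ℝ) * (1 - t) - ((c : ℝ) + (a : ℝ) - 2) * t + (a : ℝ) * s * t * (1 - t) / (1 - s * t))) + (-((t ^ (-(a : ℝ)) * (1 - t) ^ ((c : ℝ) + (a : ℝ) - 2) * (1 - s * t) ^ (-(a : ℝ)) * u ^ (-(a : ℝ)) * (1 - u) ^ ((c : ℝ) + (a : ℝ) - 2) * (1 - (1 - s) * u) ^ (-(a : ℝ))) * t * ((1 - 2 * u) - (a : ℝ) * (1 - u) - ((c : ℝ) + (a : ℝ) - 2) * u + (a : ℝ) * (1 - s) * u * (1 - u) / (1 - (1 - s) * u))))) s := by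
  intro a c t u s _ _ _ ht hu hs
  obtain ⟨_, ht₁⟩ := ht
  obtain ⟨_, hu₁⟩ := hu
  obtain ⟨hs₀, hs₁⟩ := hs
  have hp : 0 < 1 - s * t :=
    sub_pos.2 (mul_lt_one_of_nonneg_of_lt_one_left hs₀.le hs₁ ht₁.le)
  have hq : 0 < 1 - (1 - s) * u :=
    sub_pos.2 (mul_lt_one_of_nonneg_of_lt_one_left (sub_nonneg.2 hs₁.le) (sub_lt_self 1 hs₀)
      hu₁.le)
  have h1 := hasDerivAt_rpow_one_sub_mul (p := t) (m := s) (e := -(a : ℝ)) hp.ne'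
  have h2 := hasDerivAt_rpow_one_sub_one_sub_mul (q := u) (m := s) (e := -(a : ℝ)) hq.ne'
  have h3 : HasDerivAt (fun σ : ℝ => 1 - σ * t - (1 - σ) * u) (-(1 * t) - -1 * u) s :=
    (((hasDerivAt_id' s).mul_const t).const_sub 1).fun_sub
      (((hasDerivAt_id' s).const_sub 1).mul_const u)
  refine (((((h1.const_mul (t ^ (-(a : ℝ)) * (1 - t) ^ ((c : ℝ) + (a : ℝ) - 2))).mul_const
    (u ^ (-(a : ℝ)))).mul_const ((1 - u) ^ ((c : ℝ) + (a : ℝ) - 2))).fun_mul h2).fun_mul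
    h3).congr_deriv ?_
  have hpinv : (1 - s * t) * (1 - s * t)⁻¹ = 1 := mul_inv_cancel₀ hp.ne'
  have hqinv : (1 - (1 - s) * u) * (1 - (1 - s) * u)⁻¹ = 1 := mul_inv_cancel₀ hq.ne'
  linear_combination
    (t ^ (-(a : ℝ)) * (1 - t) ^ ((c : ℝ) + (a : ℝ) - 2) * (1 - s * t) ^ (-(a : ℝ)) * u ^ (-(a : ℝ)) *
          (1 - u) ^ ((c : ℝ) + (a : ℝ) - 2) * (1 - (1 - s) * u) ^ (-(a : ℝ))) * (a : ℝ) *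
      (t * (1 - u) * hpinv - u * (1 - t) * hqinv)

/-- Continuity of the Elliott family `σ ↦ K(t, u, σ) (1 − σ t − (1 − σ) u)` in the modulus on
`[0, z₁]`, `z₁ < 1`, for interior `(t, u) ∈ (0, 1)²`: the bases `1 − σ t` and `1 − (1 − σ) u` of the
two `σ`-dependent factors stay positive there, so there is no singularity at the cusp `σ = 0`.
[folklore] -/
theorem stub_elliottContinuousModulus :
    ∀ (a c : ℚ) (t u z₁ : ℝ), 0 < a → a < 1 → 1 - a < c → t ∈ Set.Ioo (0:ℝ) 1 → u ∈ Set.Ioo (0:ℝ) 1 → z₁ < 1 → ContinuousOn (fun σ : ℝ => ((t ^ (-(a : ℝ)) * (1 - t) ^ ((c : ℝ) + (a : ℝ) - 2) * (1 - σ * t) ^ (-(a : ℝ)) * u ^ (-(a : ℝ)) * (1 - u) ^ ((c : ℝ) + (a : ℝ) - 2) * (1 - (1 - σ) * u) ^ (-(a : ℝ))) * (1 - σ * t - (1 - σ) * u))) (Set.Icc 0 z₁) := by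
  intro a c t u z₁ _ _ _ ht hu hz
  obtain ⟨_, ht₁⟩ := ht
  obtain ⟨hu₀, hu₁⟩ := hu
  have hP : ContinuousOn (fun σ : ℝ => (1 - σ * t) ^ (-(a : ℝ))) (Set.Icc 0 z₁) := by
    refine ContinuousOn.rpow_const (by fun_prop) fun σ hσ => Or.inl ?_
    exact (sub_pos.2 (mul_lt_one_of_nonneg_of_lt_one_left hσ.1 (hσ.2.trans_lt hz) ht₁.le)).ne'
  have hQ : ContinuousOn (fun σ : ℝ => (1 - (1 - σ) * u) ^ (-(a : ℝ))) (Set.Icc 0 z₁) := by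
    refine ContinuousOn.rpow_const (by fun_prop) fun σ hσ => Or.inl ?_
    exact (sub_pos.2 (mul_lt_one_of_nonneg_of_lt_one_right (sub_le_self 1 hσ.1) hu₀.le hu₁)).ne'
  refine ContinuousOn.fun_mul ?_ (by fun_prop)
  refine ContinuousOn.fun_mul ?_ hQ
  refine ContinuousOn.fun_mul (ContinuousOn.fun_mul ?_ continuousOn_const) continuousOn_const
  exact continuousOn_const.fun_mul hP

end Summit.KontsevichZagierPeriods.KontsevichZagierPeriods.CompleteModGammaSectorEngine
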